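import Literature.Probability.Percolation.BondInterfaceFaceDomainULC
import Literature.Probability.LatticeModels.MeshDomainJordan
import HarnessLib

/-!
# Bulk ⇒ inner cells near a compact (stub of line `face-kernel-k1`)

For a Jordan domain `J` and a compact `K ⊆ J`, every face of a discrete Dobrushin datum on `J`
of small positive mesh whose closed cell meets `K` is an inner face: the closed cell has
diameter `≤ 2δ`, so it lies in a compact thickening `K' ⊆ J` of `K`; its corners are then in the
bulk `meshDomain J δ` by `JordanDomain.exists_forall_mem_meshDomain_and_reachable`, and its sides
lie in `K' ⊆ J ⊆ closure J`.
-/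

noncomputable section

open scoped Topology
open Filter Set Metric
open Literature.Probability Literature.Probability.LatticeModels Literature.Probability.Percolation
open Literature.Probability.LatticeModels.DiscreteDobrushin Literature.Probability.LatticeModels.Mesh
open Literature.Probability.RandomPlanarGeometry

namespace Summit.CriticalPhenomena.CardyFormulaZ2.Cruxes.ParafermionToSLESixFamilies.FaceKernel

/-- **Bulk ⇒ inner cells near a compact.** For a Jordan domain `J` and a compact
`K ⊆ J`, for every discrete Dobrushin datum on `J` of small positive mesh, every face whose closed
cell meets `K` is an inner face. -/
theorem stub_isInnerFace_near_compact :
    ∀ (J : JordanDomain) (K : Set ℂ), IsCompact K → K ⊆ J.carrier →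
      ∃ δ₀ > 0, ∀ (E : DiscreteDobrushin), E.Ω = J.carrier → 0 < E.δ → E.δ < δ₀ →
        ∀ (F : Site 2) (z : ℂ), z ∈ K → z ∈ closure (cell E.δ (F 0) (F 1)) → E.IsInnerFace F := by
  intro J K hK hKJ
  -- a compact thickening `K' = cthickening ρ K ⊆ J`
  obtain ⟨ρ, hρ, hρK⟩ := hK.exists_cthickening_subset_open J.isOpen hKJ
  -- the bulk theorem for `K'`
  obtain ⟨δ₁, hδ₁, hbulk⟩ :=
    J.exists_forall_mem_meshDomain_and_reachable (hK.cthickening (r := ρ)) hρK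
  refine ⟨min δ₁ (ρ / 2), lt_min hδ₁ (half_pos hρ), ?_⟩
  intro E hΩ hδ hδlt F z hzK hzF v w hv hw hadj
  have hδ₁' : E.δ < δ₁ := hδlt.trans_le (min_le_left _ _)
  have hδρ : 2 * E.δ ≤ ρ := by
    have h2 : E.δ < ρ / 2 := hδlt.trans_le (min_le_right _ _)
    linarith
  -- every point of the closed cell of `F` is within `2δ ≤ ρ` of `z ∈ K`, hence in `K'`
  have hmem : ∀ x ∈ closure (cell E.δ (F 0) (F 1)), x ∈ cthickening ρ K := fun x hx =>
    Metric.mem_cthickening_of_dist_le x z ρ K hzK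
      ((dist_le_of_mem_closure_cell hδ hx hzF).trans hδρ)
  have hbulk1 := (hbulk E.δ hδ hδ₁').1
  rw [hΩ]
  refine discreteDomainGraph_adj_iff.2 ⟨meshGraph_adj_iff.2 ⟨hadj, fun x hx => ?_⟩, ?_, ?_⟩
  · exact subset_closure (hρK (hmem x (segment_subset_closure_cell_of_isCorner hδ hv hw hx)))
  · exact hbulk1 v (hmem _ (meshPoint_mem_closure_cell_of_isCorner hδ hv))
  · exact hbulk1 w (hmem _ (meshPoint_mem_closure_cell_of_isCorner hδ hw))

end Summit.CriticalPhenomena.CardyFormulaZ2.Cruxes.ParafermionToSLESixFamilies.FaceKernel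

end
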